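import Summits.CriticalPhenomena.PercolationContinuityZ3.Theorems.PercNearOneGluingNoHeavyQuantMeanLineTransport
import HarnessLib

/-!
# QUANT lane R8, T-DEC: THE MEAN-LINE TRANSPORT IN CLOSED FORM — the proportional split gives ONE explicit inequality per pair of siblings
# (`ρ_a + ρ_b ≤ 1`) under which the forest is SDEC at the TRUE floor, GIVEN the oracle, for every width

builds on p205010 (kernel theorem, internal audit signed; external expert review pending)

Support file (`--supports stmt-CriticalPhenomena-4575`), QUANT lane seat prim-quant-census-1 (gen 27), rung R8 of
`run/shared/lean/prim/quant/LADDER.md`; memo `run/shared/lean/prim/quant/prim-quant-census-1/g27/PAIRFLOW-G27.md` §7.  Theorems only, standard axioms,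
no sorries.  A COROLLARY of ✓ `…QuantMeanLineTransport` (`sdec_flaw_of_meanLineTransport`): the transport is chosen PROPORTIONAL TO CAPACITY.

THE RULE.  In the transportation problem of the mean-line family (node `a` must ship its singleton mass `π_a = q_a Π_{i≠a}(1−qᵢ)` to its incident edges, the edge
`{a,b}` holds at most the pair mass `π_{ab}`), let node `a` split proportionally to `q_b/(1−q_b)` (i.e. to the capacities `π_{ab} = π_a q_b/(1−q_b)`):
`z_{ab} = π_a·(q_b/(1−q_b))/D_a`, `D_a = Σ_{b≠a} (m_b − (fm − m_a))·q_b/(1−q_b)`.  The node equations hold identically, and the load of the edge `{a,b}` is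
`π_{ab}·(ρ_a + ρ_b)` with the UTILISATIONS `ρ_a = (fm − m_a)/D_a`.  Hence the closed-form test: `ρ_a + ρ_b ≤ 1` for every pair — with equal means `m` and
`Q = Σq ∈ (1,2)`: `ρ_a = (Q−1)/((2−Q)·Σ_{b≠a} q_b/(1−q_b))`; at width 3 this is the rule that certifies 321 of the 340 grid triples of the mean-line region
(memo §7, `k3_meanline_rule.py`).

* **`sdec_flaw_of_meanLineRatio`**: the hypotheses of `sdec_flaw_of_meanLineTransport` with the transport replaced by `D` (passed with its defining
  equation), `0 < D a`, and `(fm − m_a)·D_b + (fm − m_b)·D_a ≤ D_a·D_b` for all `a ≠ b`.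

HONEST STATUS.  A k-general sub-family of the open core with an explicit membership test; `SiblingStep` ⟺ `GateStepN`, `UPartStep`, `LightResidDECOracle`,
`FarTreeRow` remain OPEN; RATE class (log\*) and the honest sentence of `run/shared/lean/prim/quant/README.md` unchanged.  [this work]; nothing here is cited as a
published result.  The gluing rows served [cite: KozmaNitzan2024, Conjecture 3 (p. 15)]; product measure [cite: Grimmett1999, §1.3 p. 10].
-/

noncomputable section

open scoped BigOperators

namespace Summit.CriticalPhenomena.PercolationContinuityZ3.Theorems
namespace Quant
namespace LawDec

open Finset

/-- removing a second point from the complement product: `(Π_{i ≠ a} f i) = f b · Π_{i ∉ {a,b}} f i` for `b ≠ a`. [this work] -/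
theorem prod_sdiff_singleton_eq_mul {n : ℕ} (f : Fin n → ℝ) (a b : Fin n) (hab : a ≠ b) :
    ∏ i ∈ Finset.univ \ {a}, f i = f b * ∏ i ∈ Finset.univ \ {a, b}, f i := by
  classical
  have hb : b ∈ Finset.univ \ ({a} : Finset (Fin n)) :=
    Finset.mem_sdiff.2 ⟨Finset.mem_univ b, fun h => hab (Finset.mem_singleton.1 h).symm⟩
  rw [← Finset.mul_prod_erase _ f hb]
  congr 1
  refine Finset.prod_congr ?_ fun _ _ => rfl
  ext i
  simp only [Finset.mem_erase, Finset.mem_sdiff, Finset.mem_univ, Finset.mem_insert, Finset.mem_singleton, true_and, not_or]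
  tauto

/-- **THE MEAN-LINE TRANSPORT IN CLOSED FORM (every width; SDEC form, given the oracle).**  See the module docstring: with
`D a = Σ_{b≠a}(m_b − (fm − m_a))·q_b/(1−q_b) > 0` and `(fm − m_a)·D b + (fm − m_b)·D a ≤ D a·D b` for all `a ≠ b` (i.e. `ρ_a + ρ_b ≤ 1`), the
proportional transport satisfies the node equations and edge inequalities of `sdec_flaw_of_meanLineTransport`. [this work] -/
theorem sdec_flaw_of_meanLineRatio {x : ℝ} (hx0 : 0 < x) (hx1 : x < 1) (L : List Sib)
    (hL : ∀ t ∈ L, t.TreeOK x) (hn : 2 ≤ L.length)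
    (hO : ∀ (x' : ℝ) (n' M' : ℕ) (μ' : ℕ → ℝ), n' < fgates L → TreeBuiltN x' n' M' μ' → SDEC x' M' μ')
    (hpair : ∀ a b : Fin L.length, a ≠ b → fmean L ≤ (L.get a).mean + (L.get b).mean)
    (hlt : ∀ a : Fin L.length, (L.get a).mean < fmean L)
    (hfl2 : ∀ a b : Fin L.length, a ≠ b → x * (L.get b).mean ≤ (fmean L - (L.get a).mean) * (L.get b).x₁)
    (hfl : ∀ i : Fin L.length, x * ∑ l, (L.get l).mean ≤ fmean L * (L.get i).x₁)
    (D : Fin L.length → ℝ)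
    (hD : ∀ a, D a = ∑ b ∈ Finset.univ.erase a,
      ((L.get b).mean - (fmean L - (L.get a).mean)) * (L.get b).q / (1 - (L.get b).q))
    (hD0 : ∀ a, 0 < D a)
    (hρ : ∀ a b : Fin L.length, a ≠ b →
      (fmean L - (L.get a).mean) * D b + (fmean L - (L.get b).mean) * D a ≤ D a * D b) :
    SDEC x (ftop L) (flaw L) := by
  classical
  have hget : ∀ i : Fin L.length, (L.get i).TreeOK x := fun i => hL _ (List.get_mem L i)
  set q : Fin L.length → ℝ := fun i => (L.get i).q with hqdef
  set m : Fin L.length → ℝ := fun i => (L.get i).mean with hmdef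
  set fm : ℝ := fmean L with hfmdef
  have hq0 : ∀ i, 0 < q i := fun i => (hget i).1
  have hq1 : ∀ i, q i < 1 := fun i => (hget i).2.1
  have hl0 : ∀ i, 0 < 1 - q i := fun i => by linarith [hq1 i]
  -- singleton masses and the proportional transport
  set P : Fin L.length → ℝ := fun a => q a * ∏ i ∈ Finset.univ \ {a}, (1 - q i) with hPdef
  have hP0 : ∀ a, 0 ≤ P a := fun a => mul_nonneg (hq0 a).le (Finset.prod_nonneg fun i _ => (hl0 i).le)
  set z : Fin L.length → Fin L.length → ℝ := fun a b => P a * (q b / (1 - q b)) / D a with hzdef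
  have hz0 : ∀ a b, 0 ≤ z a b := fun a b =>
    div_nonneg (mul_nonneg (hP0 a) (div_nonneg (hq0 b).le (hl0 b).le)) (hD0 a).le
  -- node equations: identically
  have hnode : ∀ a : Fin L.length,
      ∑ b ∈ Finset.univ.erase a, ((L.get b).mean - (fmean L - (L.get a).mean)) * z a b
        = (L.get a).q * ∏ i ∈ Finset.univ \ {a}, (1 - (L.get i).q) := by
    intro a
    have e : ∀ b ∈ Finset.univ.erase a, ((L.get b).mean - (fmean L - (L.get a).mean)) * z a b
        = P a / D a * (((L.get b).mean - (fmean L - (L.get a).mean)) * (L.get b).q / (1 - (L.get b).q)) := by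
      intro b _
      show (m b - (fm - m a)) * (P a * (q b / (1 - q b)) / D a) = P a / D a * ((m b - (fm - m a)) * q b / (1 - q b))
      ring
    rw [Finset.sum_congr rfl e, ← Finset.mul_sum, ← hD a, div_mul_cancel₀ _ (hD0 a).ne']
  -- edge inequalities: the load of `{a,b}` is `π_ab (ρ_a + ρ_b)`
  have hedge : ∀ a b : Fin L.length, a ≠ b →
      (fmean L - (L.get a).mean) * z a b + (fmean L - (L.get b).mean) * z b a
        ≤ (L.get a).q * (L.get b).q * ∏ i ∈ Finset.univ \ {a, b}, (1 - (L.get i).q) := by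
    intro a b hab
    set Pab : ℝ := q a * q b * ∏ i ∈ Finset.univ \ {a, b}, (1 - q i) with hPab
    have hPab0 : 0 ≤ Pab := mul_nonneg (mul_nonneg (hq0 a).le (hq0 b).le) (Finset.prod_nonneg fun i _ => (hl0 i).le)
    have hla : (1 - q a) ≠ 0 := (hl0 a).ne'
    have hlb : (1 - q b) ≠ 0 := (hl0 b).ne'
    have ea : P a * (q b / (1 - q b)) = Pab := by
      show q a * (∏ i ∈ Finset.univ \ {a}, (1 - q i)) * (q b / (1 - q b)) = q a * q b * ∏ i ∈ Finset.univ \ {a, b}, (1 - q i)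
      rw [prod_sdiff_singleton_eq_mul (fun i => 1 - q i) a b hab]
      rw [show q a * ((1 - q b) * ∏ i ∈ Finset.univ \ {a, b}, (1 - q i)) * (q b / (1 - q b))
          = q a * q b * (∏ i ∈ Finset.univ \ {a, b}, (1 - q i)) * ((1 - q b) / (1 - q b)) from by ring, div_self hlb, mul_one]
    have eb : P b * (q a / (1 - q a)) = Pab := by
      show q b * (∏ i ∈ Finset.univ \ {b}, (1 - q i)) * (q a / (1 - q a)) = q a * q b * ∏ i ∈ Finset.univ \ {a, b}, (1 - q i)
      rw [prod_sdiff_singleton_eq_mul (fun i => 1 - q i) b a hab.symm, Finset.pair_comm b a]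
      rw [show q b * ((1 - q a) * ∏ i ∈ Finset.univ \ {a, b}, (1 - q i)) * (q a / (1 - q a))
          = q a * q b * (∏ i ∈ Finset.univ \ {a, b}, (1 - q i)) * ((1 - q a) / (1 - q a)) from by ring, div_self hla, mul_one]
    show (fm - m a) * (P a * (q b / (1 - q b)) / D a) + (fm - m b) * (P b * (q a / (1 - q a)) / D b) ≤ Pab
    rw [ea, eb]
    have hDa := hD0 a; have hDb := hD0 b
    have hρ' : (fm - m a) / D a + (fm - m b) / D b ≤ 1 := by
      rw [div_add_div _ _ hDa.ne' hDb.ne', div_le_one (mul_pos hDa hDb)]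
      linear_combination hρ a b hab
    calc (fm - m a) * (Pab / D a) + (fm - m b) * (Pab / D b) = Pab * ((fm - m a) / D a + (fm - m b) / D b) := by ring
      _ ≤ Pab * 1 := mul_le_mul_of_nonneg_left hρ' hPab0
      _ = Pab := mul_one _
  exact sdec_flaw_of_meanLineTransport hx0 hx1 L hL hn hO hpair hlt hfl2 hfl z hz0 hnode hedge

end LawDec
end Quant
end Summit.CriticalPhenomena.PercolationContinuityZ3.Theorems
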